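import Literature.AlgebraicGeometry.GaoUllmo2025.ClosureEmbeddings
import Mathlib.LinearAlgebra.Matrix.NonsingularInverse
import Mathlib.RingTheory.Trace.Basic
import HarnessLib

/-!
# Gao–Ullmo 2025, proof of Theorem 3.1: the averaged classes `f_u = Σ_ρ ρ(u) · ρ[P]` are rational

Z. Gao, E. Ullmo, *Hodge cycles and quadratic relations between holomorphic periods on CM abelian varieties*,
J. Inst. Math. Jussieu **25** (2025) 215–249 = arXiv:2411.12249 [GaoUllmo2025], §3.1, proof of Theorem 3.1, second
paragraph (art. p. 11, chunk p0012 L14 of the held published text `corpus:paper:galaxy-pdf-4667137180`), verbatim: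
"Let `{u_1, …, u_r}` be a basis of `E^c` over `ℚ`, with `r = [E^c : ℚ]`. Set `f_j := Σ_{σ ∈ G} σ(u_j)[σP]` for
each `j ∈ {1, …, r}`. Then `σ(f_j) = f_j` for each `σ ∈ Gal(E^c/ℚ)`, and `f_j ∈ H^{p,p}(A, ℂ)` by (3.2). So
`f_j ∈ B^p(A)`."

This module supplies the step "`σ(f_j) = f_j`, so `f_j` is rational" over the typed model (where rationality of a
class is MEMBERSHIP in `ratStr E r = ⋀^r_ℚ H¹(A, ℚ)`, not Galois-invariance, so an explicit computation is needed),
with the sum run over the EMBEDDINGS `ρ : E^c → ℂ` (`= ι ∘ σ`, `ClosureEmbeddings.autOfEmb`):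

* Stage C (`e_eq_sum`, `map_CL`): the standard basis vector `φ ∈ ℂ^S` is `φ = Σ_m C_{φ m} · b_m`, an
  `E^c`-combination of the rational vectors `b_m = ratVec(b_m)` (`b_m` a `ℚ`-basis of `E`), with `C = (ᵗA)⁻¹`,
  `A = (ψ(b_m))_{ψ,m}` invertible by Dedekind's independence of characters (`isUnit_AC`); and the coefficients are
  permuted by the embeddings, `ρ(C_{φ m}) = C_{ρφ, m}` (`map_CL`, `map_CL_apply`).
* Stage D (`Tvec`, `fvec`, `fvec_mem_ratStr`): `ρ[P] := ⋀_k e_{ρφ_k}` and `f_u := Σ_ρ ρ(u) · ρ[P]`; expanding,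
  `f_u = Σ_g Tr_{E^c/ℚ}(u ∏_k C_{φ_k g(k)}) · b_{g(1)} ∧ ⋯ ∧ b_{g(r)}` (Mathlib `trace_eq_sum_embeddings`), a
  RATIONAL class.

## References

* [GaoUllmo2025] Z. Gao, E. Ullmo, J. Inst. Math. Jussieu 25 (2025) 215–249 — proof of Theorem 3.1, §3.1, art.
  p. 11 (second paragraph).

## Provenance

Staged by the pub-hodgecm formalisation cell (lineage `pub-hodgecm-pohl`) under the LEAN-IN-TREE rule; supersedes
§§Coeff, Descent of the standalone package's `HodgeCM/Literature/GaoUllmoTheorem31.lean` (gate run 20), namespace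
`HodgeCM.GaoUllmo` ↦ `Literature.AlgebraicGeometry.GaoUllmo2025`.
-/

noncomputable section

open Module

attribute [local instance] Classical.propDecidable

namespace Literature.AlgebraicGeometry.GaoUllmo2025

/-! #### Stage C: the basis vectors `φ ∈ ℂ^S` as combinations of rational vectors, with `E^c`-coefficients permuted
by the embeddings -/

section Coeff

variable {E : Type} [CommRing E] [Algebra ℚ E] [Module.Finite ℚ E]

omit [Module.Finite ℚ E] in
/-- Dedekind's independence of characters for `Hom(E, ℂ)`. [folklore] -/
theorem linearIndependent_emb : LinearIndependent ℂ (fun φ : Emb E => ((φ : E →* ℂ) : E → ℂ)) :=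
  (linearIndependent_monoidHom E ℂ).comp (fun φ : Emb E => (φ : E →* ℂ))
    (fun _ _ hφψ => AlgHom.ext fun a => DFunLike.congr_fun hφψ a)

/-- `S ≃ {1,…,n}`, `n = [E:ℚ]` (CM algebra, `card_emb_eq_finrank`). [folklore] -/
def embEquivFin (hE : IsCMAlgebra E) : Emb E ≃ Fin (finrank ℚ E) :=
  Fintype.equivFinOfCardEq (card_emb_eq_finrank hE)

/-- A `ℚ`-basis `(b_m)` of `E = H¹(A, ℚ)`. [folklore] -/
abbrev bE (E : Type) [CommRing E] [Algebra ℚ E] [Module.Finite ℚ E] : Basis (Fin (finrank ℚ E)) ℚ E :=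
  Module.finBasis ℚ E

/-- The matrix `A = (ψ_k(b_m))_{k,m}` over `ℂ` … [folklore] -/
def AC (hE : IsCMAlgebra E) : Matrix (Fin (finrank ℚ E)) (Fin (finrank ℚ E)) ℂ :=
  Matrix.of fun k m => ((embEquivFin hE).symm k) (bE E m)

/-- … and over `E^c`. [folklore] -/
def AL (hE : IsCMAlgebra E) : Matrix (Fin (finrank ℚ E)) (Fin (finrank ℚ E)) (galoisClosure E) :=
  Matrix.of fun k m => corestrict E ((embEquivFin hE).symm k) (bE E m)

/-- `AL` maps to `AC` under `E^c ⊂ ℂ`. [folklore] -/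
theorem AL_map (hE : IsCMAlgebra E) : (AL hE).map (algebraMap (galoisClosure E) ℂ) = AC hE := by
  ext k m; rfl

/-- `A` is invertible (Dedekind: a relation among the rows is a relation among the characters `ψ_k`). [folklore] -/
theorem isUnit_AC (hE : IsCMAlgebra E) : IsUnit (AC hE) := by
  rw [← Matrix.linearIndependent_rows_iff_isUnit]
  rw [linearIndependent_iff']
  intro s c hc k hk
  have hfun : ∑ i ∈ s, c i • (fun a : E => ((embEquivFin hE).symm i) a) = 0 := by
    funext a
    have ha : a = ∑ m, (bE E).repr a m • bE E m := ((bE E).sum_repr a).symm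
    simp only [Finset.sum_apply, Pi.smul_apply, smul_eq_mul, Pi.zero_apply]
    have hrow : ∀ i, ((embEquivFin hE).symm i) a =
        ∑ m, ((bE E).repr a m : ℂ) * ((embEquivFin hE).symm i) (bE E m) := by
      intro i
      conv_lhs => rw [ha]
      rw [map_sum]
      refine Finset.sum_congr rfl fun m _ => ?_
      rw [map_smul, Algebra.smul_def]
      rfl
    simp_rw [hrow, Finset.mul_sum]
    rw [Finset.sum_comm]
    refine Finset.sum_eq_zero fun m _ => ?_
    have hcm := congr_fun hc m
    simp only [Finset.sum_apply, Pi.smul_apply, smul_eq_mul, Pi.zero_apply, Matrix.row_apply] at hcm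
    calc ∑ i ∈ s, c i * (((bE E).repr a m : ℂ) * ((embEquivFin hE).symm i) (bE E m))
        = ((bE E).repr a m : ℂ) * ∑ i ∈ s, c i * AC hE i m := by
          rw [Finset.mul_sum]; refine Finset.sum_congr rfl fun i _ => ?_; simp only [AC, Matrix.of_apply]; ring
      _ = 0 := by rw [hcm, mul_zero]
  have hli := (linearIndependent_emb (E := E)).comp (embEquivFin hE).symm (embEquivFin hE).symm.injective
  rw [linearIndependent_iff'] at hli
  exact hli s c hfun k hk

/-- `det A ≠ 0` over `E^c`. [folklore] -/
theorem isUnit_AL_det (hE : IsCMAlgebra E) : IsUnit (AL hE).det := by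
  rw [isUnit_iff_ne_zero]
  intro h
  have h2 : (AC hE).det = 0 := by
    rw [← AL_map, ← RingHom.mapMatrix_apply, ← RingHom.map_det, h, map_zero]
  exact (Matrix.isUnit_iff_isUnit_det _ |>.mp (isUnit_AC hE)).ne_zero h2

/-- `C = (ᵗA)⁻¹` over `E^c` … [folklore] -/
def CL (hE : IsCMAlgebra E) : Matrix (Fin (finrank ℚ E)) (Fin (finrank ℚ E)) (galoisClosure E) :=
  ((AL hE).transpose)⁻¹

/-- … and over `ℂ`. [folklore] -/
def CC (hE : IsCMAlgebra E) : Matrix (Fin (finrank ℚ E)) (Fin (finrank ℚ E)) ℂ := ((AC hE).transpose)⁻¹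

/-- `C · ᵗA = 1`. [folklore] -/
theorem CL_mul (hE : IsCMAlgebra E) : CL hE * (AL hE).transpose = 1 :=
  Matrix.nonsing_inv_mul _ (by rw [Matrix.det_transpose]; exact isUnit_AL_det hE)

/-- **`φ = Σ_m C_{φ m} · b_m`** in `ℂ^S`: the standard basis vector `φ` is an `E^c`-combination of the rational
vectors `ratVec(b_m)`. [folklore] -/
theorem e_eq_sum (hE : IsCMAlgebra E) (φ : Emb E) :
    e E φ = ∑ m, ((CL hE (embEquivFin hE φ) m : galoisClosure E) : ℂ) • ratVec E (bE E m) := by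
  ext ψ
  simp only [e, Pi.basisFun_apply, Finset.sum_apply, Pi.smul_apply, ratVec_apply, smul_eq_mul]
  have h := congr_fun (congr_fun (CL_mul hE) (embEquivFin hE φ)) (embEquivFin hE ψ)
  rw [Matrix.mul_apply] at h
  have h' : ∑ m, ((CL hE (embEquivFin hE φ) m : galoisClosure E) : ℂ) * ψ (bE E m) =
      (((1 : Matrix _ _ (galoisClosure E)) (embEquivFin hE φ) (embEquivFin hE ψ) : galoisClosure E) : ℂ) := by
    rw [← h]
    push_cast
    refine Finset.sum_congr rfl fun m _ => ?_
    simp only [Matrix.transpose_apply, AL, Matrix.of_apply, Equiv.symm_apply_apply, coe_corestrict_apply]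
  rw [h', Matrix.one_apply]
  by_cases hφψ : φ = ψ
  · subst hφψ; simp
  · have : embEquivFin hE φ ≠ embEquivFin hE ψ := fun h => hφψ ((embEquivFin hE).injective h)
    rw [if_neg this, Pi.single_eq_of_ne' hφψ]
    simp

/-- The permutation of `{1,…,n}` induced by `ρ` on `S`. [folklore] -/
def permOfEmb (hE : IsCMAlgebra E) (ρ : galoisClosure E →ₐ[ℚ] ℂ) : Equiv.Perm (Fin (finrank ℚ E)) :=
  (embEquivFin hE).symm.trans ((Equiv.ofBijective _ (embAct_bijective ρ)).trans (embEquivFin hE))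

/-- `permOfEmb` is `embAct` transported to `{1,…,n}`. [folklore] -/
theorem embEquivFin_symm_permOfEmb (hE : IsCMAlgebra E) (ρ : galoisClosure E →ₐ[ℚ] ℂ) (k : Fin (finrank ℚ E)) :
    (embEquivFin hE).symm (permOfEmb hE ρ k) = embAct ρ ((embEquivFin hE).symm k) := by
  simp [permOfEmb]

/-- `ρ` applied to `A` over `E^c` permutes the rows of `A` over `ℂ`. [folklore] -/
theorem AL_map_emb (hE : IsCMAlgebra E) (ρ : galoisClosure E →ₐ[ℚ] ℂ) :
    (AL hE).map ρ = (AC hE).submatrix (permOfEmb hE ρ) id := by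
  ext k m
  simp only [Matrix.map_apply, AL, AC, Matrix.of_apply, Matrix.submatrix_apply, id_eq,
    embEquivFin_symm_permOfEmb, embAct_apply]

/-- **Equivariance of the coefficients**: `ρ(C_{φ m}) = C_{ρφ, m}`. [folklore] -/
theorem map_CL (hE : IsCMAlgebra E) (ρ : galoisClosure E →ₐ[ℚ] ℂ) :
    (CL hE).map ρ = (CC hE).submatrix (permOfEmb hE ρ) id := by
  have hinv : (CL hE).map ρ = (((AL hE).transpose).map ρ)⁻¹ := by
    apply (Matrix.inv_eq_left_inv _).symm
    rw [← Matrix.map_mul, CL_mul, Matrix.map_one _ (map_zero ρ) (map_one ρ)]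
  rw [hinv, Matrix.transpose_map, AL_map_emb, Matrix.transpose_submatrix, CC]
  have : ((AC hE).transpose.submatrix id (permOfEmb hE ρ)) =
      (AC hE).transpose.submatrix (Equiv.refl _) (permOfEmb hE ρ) := rfl
  rw [this, Matrix.inv_submatrix_equiv]
  rfl

/-- The inclusion `E^c ⊂ ℂ` induces the identity permutation. [folklore] -/
theorem permOfEmb_val (hE : IsCMAlgebra E) : permOfEmb hE (galoisClosure E).val = Equiv.refl _ := by
  ext k : 1
  apply (embEquivFin hE).symm.injective
  rw [embEquivFin_symm_permOfEmb, embAct_val]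
  rfl

/-- `CL` maps to `CC` under `E^c ⊂ ℂ`. [folklore] -/
theorem coe_CL (hE : IsCMAlgebra E) (k m : Fin (finrank ℚ E)) :
    ((CL hE k m : galoisClosure E) : ℂ) = CC hE k m := by
  have h := congr_fun (congr_fun (map_CL hE (galoisClosure E).val) k) m
  rw [Matrix.map_apply, permOfEmb_val] at h
  exact h

/-- `permOfEmb` in terms of `embEquivFin`. [folklore] -/
theorem permOfEmb_apply_embEquivFin (hE : IsCMAlgebra E) (ρ : galoisClosure E →ₐ[ℚ] ℂ) (χ : Emb E) :
    permOfEmb hE ρ (embEquivFin hE χ) = embEquivFin hE (embAct ρ χ) := by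
  apply (embEquivFin hE).symm.injective
  rw [embEquivFin_symm_permOfEmb]
  simp

/-- `ρ(C_{χ m}) = C_{ρχ, m}` in coordinates. [folklore] -/
theorem map_CL_apply (hE : IsCMAlgebra E) (ρ : galoisClosure E →ₐ[ℚ] ℂ) (χ : Emb E) (m : Fin (finrank ℚ E)) :
    ρ (CL hE (embEquivFin hE χ) m) = ((CL hE (embEquivFin hE (embAct ρ χ)) m : galoisClosure E) : ℂ) := by
  have h := congr_fun (congr_fun (map_CL hE ρ) (embEquivFin hE χ)) m
  rw [Matrix.map_apply, Matrix.submatrix_apply, id_eq, permOfEmb_apply_embEquivFin] at h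
  rw [h, coe_CL]

end Coeff

/-! #### Stage D: the averaged classes `f_u = Σ_ρ ρ(u) · ρ[P]` are rational -/

section Descent

variable {E : Type} [CommRing E] [Algebra ℚ E] [Module.Finite ℚ E] [LinearOrder (Emb E)]

/-- `ρ[P] := ⋀_k e_{ρ ∘ φ_k}`, `φ₁ < ⋯ < φ_r` the elements of `P` (the printed `[σP]`, with its natural sign; proof of
Thm 3.1, chunk p0012 L14). [cite: GaoUllmo2025, Thm 3.1 (proof, second paragraph)] -/
def Tvec (r : ℕ) (P : Set.powersetCard (Emb E) r) (ρ : galoisClosure E →ₐ[ℚ] ℂ) : Hr E r :=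
  exteriorPower.ιMulti ℂ r (fun k => e E (embAct ρ (Set.powersetCard.ofFinEmbEquiv.symm P k)))

/-- `ι[P] = [P]` for the inclusion `ι : E^c ⊂ ℂ`. [folklore] -/
theorem Tvec_val (r : ℕ) (P : Set.powersetCard (Emb E) r) : Tvec r P (galoisClosure E).val = wedge E r P := by
  simp only [Tvec, embAct_val, wedge, exteriorPower.basis_apply]
  rfl

/-- `f_u := Σ_ρ ρ(u) · ρ[P]` (the printed "`f_j := Σ_{σ ∈ G} σ(u_j)[σP]`", chunk p0012 L14, summed over embeddings).
[cite: GaoUllmo2025, Thm 3.1 (proof, second paragraph)] -/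
def fvec (r : ℕ) (P : Set.powersetCard (Emb E) r) (u : galoisClosure E) : Hr E r :=
  ∑ ρ : galoisClosure E →ₐ[ℚ] ℂ, (ρ u) • Tvec r P ρ

/-- Expansion of `ρ[P]` in wedges of rational vectors: `ρ[P] = Σ_g ρ(∏_k C_{φ_k, g(k)}) · ⋀_k b_{g(k)}`. [folklore] -/
theorem Tvec_eq_sum (hE : IsCMAlgebra E) (r : ℕ) (P : Set.powersetCard (Emb E) r)
    (ρ : galoisClosure E →ₐ[ℚ] ℂ) :
    Tvec r P ρ = ∑ g : Fin r → Fin (finrank ℚ E),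
      ρ (∏ k, CL hE (embEquivFin hE (Set.powersetCard.ofFinEmbEquiv.symm P k)) (g k)) •
        exteriorPower.ιMulti ℂ r (fun k => ratVec E (bE E (g k))) := by
  unfold Tvec
  have hfun : (fun k => e E (embAct ρ (Set.powersetCard.ofFinEmbEquiv.symm P k))) =
      fun k => ∑ m, (ρ (CL hE (embEquivFin hE (Set.powersetCard.ofFinEmbEquiv.symm P k)) m)) •
        ratVec E (bE E m) := by
    funext k
    rw [e_eq_sum hE]
    refine Finset.sum_congr rfl fun m _ => ?_
    rw [map_CL_apply]
  rw [hfun]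
  have h1 := (exteriorPower.ιMulti ℂ r (M := VC E)).toMultilinearMap.map_sum
    (fun k m => (ρ (CL hE (embEquivFin hE (Set.powersetCard.ofFinEmbEquiv.symm P k)) m)) • ratVec E (bE E m))
  rw [AlternatingMap.coe_multilinearMap] at h1
  rw [h1]
  refine Finset.sum_congr rfl fun g _ => ?_
  rw [map_prod]
  exact (exteriorPower.ιMulti ℂ r (M := VC E)).toMultilinearMap.map_smul_univ _ _

/-- **`f_u` is a rational class** (`∈ H^r(A, ℚ)`): its coefficients on the rational wedges are the traces
`Tr_{E^c/ℚ}(u ∏_k C_{φ_k, g(k)})` (the printed "`σ(f_j) = f_j` for each `σ ∈ Gal(E^c/ℚ)`", chunk p0012 L14).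
[cite: GaoUllmo2025, Thm 3.1 (proof, second paragraph)] -/
theorem fvec_mem_ratStr (hE : IsCMAlgebra E) (r : ℕ) (P : Set.powersetCard (Emb E) r) (u : galoisClosure E) :
    fvec r P u ∈ ratStr E r := by
  unfold fvec
  simp_rw [Tvec_eq_sum hE, Finset.smul_sum, smul_smul, ← map_mul]
  rw [Finset.sum_comm]
  refine Submodule.sum_mem _ fun g _ => ?_
  rw [← Finset.sum_smul, ← trace_eq_sum_embeddings ℂ, algebraMap_smul]
  exact Submodule.smul_mem _ _ (Submodule.subset_span ⟨fun k => bE E (g k), rfl⟩)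

end Descent

end Literature.AlgebraicGeometry.GaoUllmo2025

end
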